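import Literature.NumberTheory.CubicFields.CubicFieldDiscriminant307ClassNumber
import Literature.NumberTheory.NumberFields.CubicFieldDedekindKummer
import Literature.NumberTheory.NumberFields.IntegralBasisIndexTwo
import HarnessLib

/-!
# The cubic field of discriminant `−503`: `F = ℚ(θ)`, `θ³ + 6X² − 1X + 2 = 0`, `𝓞_F = ℤ ⊕ ℤθ ⊕ ℤδ`, `δ = (θ² + θ)/2`
# — a DEDEKIND-TYPE field (`2` splits completely, common index divisor `2`: NO power integral basis), `d_F = −503` (503 (prime)), signature `(1, 1)` — PROVED

Topic `Literature/NumberTheory/CubicFields`, namespace `Literature.NumberTheory.CubicFields.CubicDisc503`.  THEOREMS ONLY (no definition, no named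
fact, no instance, no notation); every statement is PROVED.  Written by the prover seat `bsd-line-att-p4` g46 (cell `bsd-f1-sign2`) on the index-two
template of `CubicFieldDiscriminant431.lean` (this seat): a cubic `2`-torsion field of the SPLIT stratum (`Δ_min ≡ 1 (mod 8)`) of route `AlignedTransportAtTwo`,
in which `2 = 𝔭_a 𝔭_b 𝔭_c` splits completely, so `2` divides the index of EVERY generator (Dedekind) and `𝓞_F` is presented as `ℤ ⊕ ℤθ ⊕ ℤδ` with
`f(θ) = 0`, `f = X³ + 6X² − 1X + 2`, `Δ(f) = 2²·(−503)`, `δ = (θ² + θ)/2` (index exactly `2`, `IntegralBasisIndexTwo`).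

## Source

[LMFDB] The L-functions and Modular Forms Database, number field `3.1.503.1` (degree `3`, signature `[1, 1]`, discriminant `−503`, class number `1`).
D. A. Marcus, *Number Fields*, 2nd ed. (2018) [Marcus2018], Ch. 2 Ex. 27, Ch. 3 Thm. 27 and Ex. 21 (Dedekind's common index divisor), Ch. 5 Thm. 37 and Cor. 2.

## Carrier

`F` is ANY number field with `[F : ℚ] = 3` containing `α` with `aeval α (MonicCubic.poly 6 -1 2) = 0`; `θ := MonicCubic.thetaInt hα ∈ 𝓞 F` and
`δ := MonicCubic.thetaInt (delta_root hα) ∈ 𝓞 F` (the algebraic integer `(α² + α)/2`).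

## What is formalised (all PROVED)

* §1 the polynomials: `disc_eq`, `squarefree_neg_503`, `irreducible_polyQ` (no root mod `3`); `delta_root`, `disc_delta_eq`, `irreducible_polyQ_delta`; the
  factorisations of `f` modulo the odd primes `≤ 6` that are not inert.
* §2 the order: `mem2` (`2·𝓞_F ⊆ ℤ[θ]`), `mem8_delta`, `not_dvd_exponent` (`p ≠ 2`), `den_delta` / `mul_table`, ★ `discr_eq` (**`d_F = −503`**, index exactly `2`),
  `nrComplexPlaces_eq_one`.
* The sequel `…503ClassNumber.lean`: the primes of norm `≤ 6` are principal (`2` = unit × three prime elements `−θ`, `δ`, `θ − δ`) and ★ `h_F = 1`.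

## References
* [LMFDB] The LMFDB Collaboration, The L-functions and Modular Forms Database, number field 3.1.503.1.
* [Marcus2018] D. A. Marcus, *Number Fields*, 2nd ed., Universitext, Springer 2018, Ch. 2 Ex. 27, Ch. 3 Thm. 27 and Ex. 21, Ch. 5 Thm. 37.
-/

noncomputable section

open Polynomial NumberField NumberField.InfinitePlace Ideal Module Real
open Literature.NumberTheory.NumberFields
open Literature.NumberTheory.NumberFields.MonicCubic

namespace Literature.NumberTheory.CubicFields.CubicDisc503

/-! ## §1 The polynomials `f = MonicCubic.poly 6 (-1) 2` (index `2`) and `g = MonicCubic.poly (-16) (-3) (-2)` (index `8`) -/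

/-- `Δ(f) = -2012 = 2²·(−503)`. [cite: LMFDB, number field 3.1.503.1 (discriminant −503)] [cite: Marcus2018, Ch. 2, Exercise 27] -/
theorem disc_eq : disc 6 (-1) 2 = 2 ^ 2 * (-503) := by
  norm_num [disc]

/-- `−503` is squarefree (`503 = 503 (prime)`). [cite: Marcus2018, Ch. 2, Exercise 27(e)] -/
theorem squarefree_neg_503 : Squarefree (-503 : ℤ) := by
  rw [← Int.squarefree_natAbs, show (-503 : ℤ).natAbs = 503 by norm_num]
  exact (by norm_num : Nat.Prime 503).squarefree

/-- `f` has no root modulo `3`. [cite: Marcus2018, Ch. 3, Thm. 27] -/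
theorem no_root_3 :
    ∀ r : ZMod 3, r ^ 3 + ((6 : ℤ) : ZMod 3) * r ^ 2 + ((-1 : ℤ) : ZMod 3) * r + ((2 : ℤ) : ZMod 3) ≠ 0 := by
  decide

/-- **`f` is irreducible over `ℚ`** (no root modulo `3`). [cite: LMFDB, number field 3.1.503.1 (degree 3)] -/
theorem irreducible_polyQ : Irreducible (polyQ 6 (-1) 2) :=
  haveI : Fact (Nat.Prime 3) := ⟨by norm_num⟩
  irreducible_polyQ_of_no_root 3 no_root_3

/-- `f mod p` written out. [cite: Marcus2018, Ch. 3, Thm. 27] -/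
theorem polyMod_eq (p : ℕ) : polyMod 6 (-1) 2 p = ((2) + (-1) * X + (6) * X ^ 2 + X ^ 3 : (ZMod p)[X]) := by
  simp [polyMod, poly]; ring

/-- `g mod p` written out. [cite: Marcus2018, Ch. 3, Thm. 27] -/
theorem polyModDelta_eq (p : ℕ) : polyMod (-16) (-3) (-2) p = ((-2) + (-3) * X + (-16) * X ^ 2 + X ^ 3 : (ZMod p)[X]) := by
  simp [polyMod, poly]; ring

/-- The factorisation of `f` modulo `5`. [cite: Marcus2018, Ch. 3, Thm. 27] -/
theorem polyMod_5 : polyMod 6 (-1) 2 5 = (X + 2) * (X ^ 2 + 4 * X + 1) := by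
  rw [polyMod_eq]
  have hp : (5 : (ZMod 5)[X]) = 0 := by
    rw [show (5 : (ZMod 5)[X]) = C 5 from (map_natCast C 5).symm, show (5 : ZMod 5) = 0 from rfl, C_0]
  linear_combination ((-2) * X : (ZMod 5)[X]) * hp
/-- The quadratic factor modulo `5` is irreducible (no root). [cite: Marcus2018, Ch. 3, Thm. 27] -/
theorem irreducible_quad_5 : Irreducible (X ^ 2 + 4 * X + 1 : (ZMod 5)[X]) := by
  have hnr : ∀ x : ZMod 5, x ^ 2 + 4 * x + 1 ≠ 0 := by decide
  haveI : Fact (Nat.Prime 5) := ⟨by norm_num⟩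
  have hdeg : (X ^ 2 + 4 * X + 1 : (ZMod 5)[X]).natDegree = 2 := by compute_degree!
  refine irreducible_of_degree_le_three_of_not_isRoot (by rw [hdeg]; decide) fun x hx => hnr x ?_
  simpa only [IsRoot.def, eval_add, eval_mul, eval_pow, eval_X, eval_ofNat, eval_one] using hx
/-- `Δ(g) = -32192 = 8²·(−503)`. [cite: Marcus2018, Ch. 2, Exercise 27] -/
theorem disc_delta_eq : disc (-16) (-3) (-2) = 8 ^ 2 * (-503) := by
  norm_num [disc]

/-- `g` has no root modulo `3`. [cite: Marcus2018, Ch. 3, Thm. 27] -/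
theorem no_root_3_delta :
    ∀ r : ZMod 3, r ^ 3 + ((-16 : ℤ) : ZMod 3) * r ^ 2 + ((-3 : ℤ) : ZMod 3) * r + ((-2 : ℤ) : ZMod 3) ≠ 0 := by
  decide

/-- `g` is irreducible over `ℚ`. [cite: Marcus2018, Ch. 3, Thm. 27] -/
theorem irreducible_polyQ_delta : Irreducible (polyQ (-16) (-3) (-2)) :=
  haveI : Fact (Nat.Prime 3) := ⟨by norm_num⟩
  irreducible_polyQ_of_no_root 3 no_root_3_delta

/-! ## §2 The field `F` and the order `𝓞_F = ℤ ⊕ ℤθ ⊕ ℤδ` -/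

section NumberField

variable {F : Type*} [Field F] [NumberField F] {α : F}

omit [NumberField F] in
/-- The cubic relation `f(α) = 0` in `F`. [cite: LMFDB, number field 3.1.503.1 (defining polynomial)] -/
theorem cubic_eq (hα : aeval α (poly 6 (-1) 2) = 0) : α ^ 3 + 6 * α ^ 2 - 1 * α + 2 = 0 := by
  have h := hα
  simp only [poly, map_add, map_mul, map_pow, aeval_X, eq_intCast, map_intCast] at h
  push_cast at h
  linear_combination h

/-- **`δ = (α ^ 2 + α) / 2` is a root of `g`.** [cite: Marcus2018, Ch. 2, Exercise 27] -/
theorem delta_root (hα : aeval α (poly 6 (-1) 2) = 0) : aeval ((α ^ 2 + α) / 2) (poly (-16) (-3) (-2)) = 0 := by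
  simp only [poly, map_add, map_mul, map_pow, aeval_X, eq_intCast, map_intCast]
  push_cast
  linear_combination (((-1 : F)) + ((-5 : F) / 4) * α + ((-3 : F) / 8) * α ^ 2 + ((1 : F) / 8) * α ^ 3) * cubic_eq hα

/-- **`2 x ∈ ℤ[θ]` for every algebraic integer `x`** (`Δ(f) = 2²·(−503)`, `−503` squarefree, so `indexDet ∣ 2`). [cite: Marcus2018, Ch. 2, Exercise 27(c)] -/
theorem mem2 (h3 : finrank ℚ F = 3) (hα : aeval α (poly 6 (-1) 2) = 0) (x : 𝓞 F) :
    ((2 : ℕ) : F) * x ∈ Algebra.adjoin ℤ ({α} : Set F) := by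
  have h := mul_mem_adjoin_of_discr_eq_sq_mul (pb irreducible_polyQ hα h3) (isIntegral_pb_gen irreducible_polyQ hα h3) 2 (-503)
    (by rw [discr_pb, disc_eq]) squarefree_neg_503 x
  rw [pb_gen] at h
  exact_mod_cast h

/-- **`8 x ∈ ℤ[δ]` for every algebraic integer `x`** (`Δ(g) = 8²·(−503)`). [cite: Marcus2018, Ch. 2, Exercise 27(c)] -/
theorem mem8_delta (h3 : finrank ℚ F = 3) (hα : aeval α (poly 6 (-1) 2) = 0) (x : 𝓞 F) :
    ((8 : ℕ) : F) * x ∈ Algebra.adjoin ℤ ({(α ^ 2 + α) / 2} : Set F) := by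
  have h := mul_mem_adjoin_of_discr_eq_sq_mul (pb irreducible_polyQ_delta (delta_root hα) h3)
    (isIntegral_pb_gen irreducible_polyQ_delta (delta_root hα) h3) 8 (-503)
    (by rw [discr_pb, disc_delta_eq]) squarefree_neg_503 x
  rw [pb_gen] at h
  exact_mod_cast h

/-- `p ∤ exponent(θ)` for every prime `p ≠ 2` (Dedekind–Kummer for `f` away from `2`). [cite: Marcus2018, Ch. 3, Thm. 27] -/
theorem not_dvd_exponent (h3 : finrank ℚ F = 3) (hα : aeval α (poly 6 (-1) 2) = 0) {p : ℕ} (hp : p.Prime) (hp2 : p ≠ 2) :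
    ¬ p ∣ RingOfIntegers.exponent (thetaInt hα) :=
  MonicCubic.not_dvd_exponent hα (mem2 h3 hα) fun h =>
    hp2 ((Nat.prime_dvd_prime_iff_eq hp (by norm_num : Nat.Prime 2)).mp h)

/-- `p ∤ exponent(δ)` for every prime `p ≠ 2` (Dedekind–Kummer for `g` at `2`). [cite: Marcus2018, Ch. 3, Thm. 27] -/
theorem not_dvd_exponent_delta (h3 : finrank ℚ F = 3) (hα : aeval α (poly 6 (-1) 2) = 0) {p : ℕ} (hp : p.Prime) (hp2 : p ≠ 2) :
    ¬ p ∣ RingOfIntegers.exponent (thetaInt (delta_root hα)) :=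
  MonicCubic.not_dvd_exponent (delta_root hα) (mem8_delta h3 hα) fun h =>
    hp2 ((Nat.prime_dvd_prime_iff_eq hp (by norm_num : Nat.Prime 2)).mp (hp.dvd_of_dvd_pow (show p ∣ 2 ^ 3 by norm_num; exact h)))

/-- **`2δ = θ² + 1θ`** in `𝓞 F`. [cite: Marcus2018, Ch. 2, Exercise 27] -/
theorem den_delta (hα : aeval α (poly 6 (-1) 2) = 0) :
    2 * thetaInt (delta_root hα) = thetaInt hα ^ 2 + 1 * thetaInt hα := by
  rw [RingOfIntegers.ext_iff]
  simp only [map_mul, map_add, map_pow, map_ofNat, map_one, MonicCubic.thetaInt, RingOfIntegers.map_mk]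
  ring

/-- **The multiplication table of `ℤ ⊕ ℤθ ⊕ ℤδ`**: `θ² = -θ + 2 * δ`, `θδ = -1 + 3 * θ - 5 * δ`, `δ² = 2 - 8 * θ + 13 * δ` (with `θ`, `δ` for the two generators) — so
`ℤ[θ, δ] = ℤ ⊕ ℤθ ⊕ ℤδ` (`= 𝓞_F`, index `2` over `ℤ[θ]`, `8` over `ℤ[δ]`). [cite: Marcus2018, Ch. 2, Exercise 27] -/
theorem mul_table (hα : aeval α (poly 6 (-1) 2) = 0) :
    thetaInt hα ^ 2 = -thetaInt hα + 2 * thetaInt (delta_root hα) ∧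
    thetaInt hα * thetaInt (delta_root hα) = -1 + 3 * thetaInt hα - 5 * thetaInt (delta_root hα) ∧
    thetaInt (delta_root hα) ^ 2 = 2 - 8 * thetaInt hα + 13 * thetaInt (delta_root hα) := by
  refine ⟨?_, ?_, ?_⟩
  · rw [RingOfIntegers.ext_iff]
    simp only [map_mul, map_add, map_neg, map_pow, map_ofNat, MonicCubic.thetaInt, RingOfIntegers.map_mk]
    linear_combination (0 : F) * cubic_eq hα
  · rw [RingOfIntegers.ext_iff]
    simp only [map_mul, map_add, map_sub, map_neg, map_ofNat, map_one, MonicCubic.thetaInt, RingOfIntegers.map_mk]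
    linear_combination (((1 : F) / 2)) * cubic_eq hα
  · rw [RingOfIntegers.ext_iff]
    simp only [map_mul, map_add, map_sub, map_pow, map_ofNat, MonicCubic.thetaInt, RingOfIntegers.map_mk]
    linear_combination (((-1 : F)) + ((1 : F) / 4) * α) * cubic_eq hα

/-- ★ **`d_F = −503`.**  `Δ(f) = 2²·(−503)` with `−503` squarefree, and `δ` is HALF-integral on `1, θ, θ²` (`2δ = θ² + 1θ`), so the index of `ℤ[θ]` in `𝓞_F` is
EXACTLY `2` (`MonicCubic.discr_eq_of_disc_eq_four_mul`): `2` is a common index divisor (Dedekind), no generator has odd index. [cite: LMFDB, number field 3.1.503.1 (discriminant −503)]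
[cite: Marcus2018, Ch. 2, Exercise 27(c)–(e)] -/
theorem discr_eq (h3 : finrank ℚ F = 3) (hα : aeval α (poly 6 (-1) 2) = 0) : discr F = -503 :=
  discr_eq_of_disc_eq_four_mul irreducible_polyQ hα h3 disc_eq squarefree_neg_503 (thetaInt (delta_root hα)) 0 1 1
    (by rw [coe_thetaInt]; push_cast; ring) (by norm_num)

/-- **`F` has exactly one complex place** (`r₂ = 1`): `d_F < 0` has sign `(−1)^{r₂}`, and `r₁ + 2r₂ = 3`. [cite: LMFDB, number field 3.1.503.1 (signature [1,1])] -/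
theorem nrComplexPlaces_eq_one (h3 : finrank ℚ F = 3) (hα : aeval α (poly 6 (-1) 2) = 0) : nrComplexPlaces F = 1 := by
  have hsum := card_add_two_mul_card_eq_rank F
  rw [h3] at hsum
  have hsign := NumberField.sign_discr F
  rw [discr_eq h3 hα] at hsign
  have hle : nrComplexPlaces F ≤ 1 := by omega
  rcases Nat.le_one_iff_eq_zero_or_eq_one.mp hle with h0 | h1
  · rw [h0, pow_zero, show (-503 : ℤ).sign = -1 from rfl] at hsign
    norm_num at hsign
  · exact h1

end NumberField

end Literature.NumberTheory.CubicFields.CubicDisc503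

end
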